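import Literature.AlgebraicGeometry.Resolution.CanonicalResolutionProofs
import HarnessLib

/-!
# Crux `SepExcModels` (stmt-ResolutionOfSingularities-16828), line `registered` (birth skeleton)
# — stub `stub_regularOrClosedSpreads`

Route `ResolutionOfSingularities/SharpStrata`. The crux's "separably exceptional at `ζ`" is the
trichotomy (regular ∨ closed ∨ separable birational local model); the sharp points fail all three,
so they lie in the bigger set `T = {ζ | ¬ (𝒪_{Y,ζ} regular ∨ {ζ} closed)}`. The skeleton proves
that the specialisation-closure of the sharp locus is closed from "propagation of bluntness": a
blunt point `w` is not a limit of sharp points of its own stratum `cl{w}`. This file is the two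
easy cases of that propagation, in tree vocabulary and for the bigger set `T`:

* `w` regular: the regular locus `Reg Y` is OPEN for `Y` locally of finite type over a field
  (`Literature.AlgebraicGeometry.Resolution.isOpen_regularLocus_of_locallyOfFiniteType_field`,
  Matsumura, Cor. to Thm. 30.5, globalised), contains `w` and misses `T`;
* `w` closed: `cl{w} = {w}` and `w ∉ T`, so `T ∩ cl{w} = ∅`.

No integrality, separatedness or perfectness is used.
-/

noncomputable section

-- single-problem summit: the doubled namespace component is forced
set_option linter.dupNamespace false

open CategoryTheory AlgebraicGeometry TopologicalSpace Topology
open Literature.AlgebraicGeometry.Resolution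

namespace Summit.ResolutionOfSingularities.ResolutionOfSingularities.Theorems.SepExcModels.RegularOrClosedSpreads

/-- **Regular points and closed points spread their bluntness** (registered stub
`stub_regularOrClosedSpreads` of the birth line of crux stmt-ResolutionOfSingularities-16828).
For a scheme `Y` locally of finite type over a field `k` and a point `w` that is regular or
closed, `w` is not in the closure of the non-regular non-closed points of `cl{w}`: if `w` is
regular, the open regular locus (`isOpen_regularLocus_of_locallyOfFiniteType_field`) is a
neighbourhood of `w` containing none of them (`mem_closure_iff`); if `w` is closed, `cl{w} = {w}`
contains none of them, so the set whose closure is taken is empty. [folklore] -/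
theorem stub_regularOrClosedSpreads (k : Type) [Field k] (Y : Scheme.{0})
    (f : Y ⟶ Spec (.of k)) [LocallyOfFiniteType f] (w : Y)
    (hw : IsRegularLocalRing (Y.presheaf.stalk w) ∨ IsClosed ({w} : Set Y)) :
    w ∉ closure ({ζ : Y | ¬ (IsRegularLocalRing (Y.presheaf.stalk ζ) ∨ IsClosed ({ζ} : Set Y))} ∩
      closure {w}) := by
  intro h
  rcases hw with hreg | hcl
  · -- the open regular locus is a neighbourhood of `w` missing every non-regular point
    obtain ⟨ζ, hζU, hζT, -⟩ := mem_closure_iff.mp h (Scheme.regularLocus Y)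
      (isOpen_regularLocus_of_locallyOfFiniteType_field f) ((Scheme.mem_regularLocus w).mpr hreg)
    exact hζT (Or.inl ((Scheme.mem_regularLocus ζ).mp hζU))
  · -- `cl{w} = {w}` and `w` itself is not in the set: the intersection is empty
    have hE : ({ζ : Y | ¬ (IsRegularLocalRing (Y.presheaf.stalk ζ) ∨ IsClosed ({ζ} : Set Y))} ∩
        closure {w}) = (∅ : Set Y) := by
      rw [hcl.closure_eq, Set.eq_empty_iff_forall_notMem]
      rintro ζ ⟨hζT, hζw⟩
      rw [Set.mem_singleton_iff] at hζw
      subst hζw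
      exact hζT (Or.inr hcl)
    rw [hE, closure_empty] at h
    exact h

end Summit.ResolutionOfSingularities.ResolutionOfSingularities.Theorems.SepExcModels.RegularOrClosedSpreads

end
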